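import Summits.AtomisticToContinuum.Crystallization.Theorems.ChartedZeroExcessLayeredLatticeLiouvilleZZZYRCZU

/-!
# Charted zero-excess layered-lattice Liouville — ZZZYRCZV: the WINDOWED θ⁰ near reader, PROOF KIT (window coordinates, lookup,
far pairs, keys and guarded tables, coefficient bounds)

Cell `decomp-a2c`, lens 2 («special vs generic»), generation 100.  Line (D) TAIL-DEBIT of `UniformEquilStabilityAt`, item 5c, R3-W.
This file and its sequel ZZZYRCZW are the generic (letter-FUNCTION) successor of the periodic near reader (ZZZYRCZ/RCZK): a configuration
in a letter-function box is read through the WINDOW DATA of its own letter sequence `ℓ`, one window per BASE LAYER of the pair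
(PAIR-CENTRED windows: the path of a near pair `x` is looked up in the data of the window around `x.1.2`, in the window coordinates
`toWin H₀ x` (base ↦ `(0, H₀)`), under the re-based sequence `winSeq ℓ H₀ x.1.2`; no cross-window consistency is needed).  Here, the kit:

§1 WINDOW COORDINATES (`wshF`, `winSeq`, `toWin`): the representative is centre-based, the pair is its translate, `n9F`/`sinSq0F` transfer;
§2 THE LOOKUP in the window data of the base layer (`dataLookupF / dataNpF / dataZF`): soundness, completeness ⇒ success, the pieces read
   off are the translated chord pieces;
§3 far pairs under `IdealLengthCmpF`: `0 ≤ n9F`, `0 < n9F`, `lo < n9F`;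
§4 THE KEY SEEN FROM A BASE LAYER `keyAtF H₀ m y = (y.1.2 − m + H₀, Δγ, Δm)` (= the raw key `pieceKeyF` of the window piece); the guarded
   tables `thetaR0G / thetaN0G` (ZZZYRCZU) with scalars as the `Q`-restricted incidence sums of the counting lemma (`tableRG_eq / tableNG_eq`,
   guard folded into `Q`); ★ valid window data has NO incidence beyond the radius: the tables VANISH at keys with `|k.1 − H₀| > R`
   (`PiecesWithin`), and `|key.1 − H₀| ≤ R ↔ m ∈ [y.1.2 − R, y.1.2 + R]`;
§5 the per-incidence COEFFICIENT BOUNDS transported through the window translation: `schemeCoefR ≤ (1+α)λ⁻⁸·coefR0F ℓₘ c`,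
   `schemeCoefN ≤ (1+α⁻¹)λ⁻⁸·(K·coefN0F + η·coefR0F)` for chords in range, and `K·coefN0F + η·coefR0F ≥ 0` (angle comparison at the
   translated datum).

Theorem file (7 defs, 24 theorems); imports ZZZYRCZU only; no instance / notation / option; 0 sorry. [g100]
-/

namespace Summit.AtomisticToContinuum.Crystallization.Theorems.ChartedZeroExcessLayeredLatticeLiouville

open scoped BigOperators RealInnerProductSpace
open Summit.AtomisticToContinuum.Crystallization.Theorems.ChartedPlanarOrderRigidityDoor (E3)

/-! ### §1 window coordinates of a pair -/

/-- the layer shift taking window coordinates (centre `H₀`) to the actual base layer of `x`. [g100] -/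
def wshF (H₀ : ℕ) (x : (Cell 2 × ℤ) × (Cell 2 × ℤ)) : ℤ := x.1.2 - (H₀ : ℤ)

/-- the letter sequence in the window coordinates of base layer `m`: window layer `j` reads actual layer `j + (m − H₀)`. [g100] -/
def winSeq (ℓ : ℤ → ℤ) (H₀ : ℕ) (m : ℤ) : ℤ → ℤ := fun j => ℓ (j + (m - (H₀ : ℤ)))

/-- the pair in the window coordinates of its own base layer: `x.1 ↦ (0, H₀)`, `x.2` translated along. [g100] -/
def toWin (H₀ : ℕ) (x : (Cell 2 × ℤ) × (Cell 2 × ℤ)) : (Cell 2 × ℤ) × (Cell 2 × ℤ) := shiftPairW (-x.1.1) (-wshF H₀ x) x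

/-- a re-based sequence of a letter sequence is a letter sequence. [g100] -/
theorem isLetterSeq_winSeq {ℓ : ℤ → ℤ} (h : IsLetterSeq ℓ) (H₀ : ℕ) (m : ℤ) : IsLetterSeq (winSeq ℓ H₀ m) := fun _ => h _

/-- `toWin H₀ x` is centre-based. [g100] -/
theorem isCenterBased_toWin (H₀ : ℕ) (x : (Cell 2 × ℤ) × (Cell 2 × ℤ)) : IsCenterBased H₀ (toWin H₀ x) := by
  refine ⟨?_, ?_⟩
  · show x.1.1 + -x.1.1 = 0
    exact add_neg_cancel _
  · show x.1.2 + -wshF H₀ x = H₀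
    unfold wshF; ring

/-- a pair is the translate of its window representative by `(x.1.1, wshF H₀ x)`. [g100] -/
theorem shiftPairW_toWin (H₀ : ℕ) (x : (Cell 2 × ℤ) × (Cell 2 × ℤ)) : shiftPairW x.1.1 (wshF H₀ x) (toWin H₀ x) = x := by
  obtain ⟨⟨γ, m⟩, ⟨γ', m'⟩⟩ := x
  simp only [shiftPairW, toWin, shiftSiteW, neg_add_cancel_right]

/-- `n9F` TRANSFER: the ideal length of `x` under `ℓ` is that of its window representative under the re-based sequence. [g100] -/
theorem n9F_toWin (ℓ : ℤ → ℤ) (H₀ : ℕ) (x : (Cell 2 × ℤ) × (Cell 2 × ℤ)) : n9F (winSeq ℓ H₀ x.1.2) (toWin H₀ x) = n9F ℓ x := by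
  have h := n9F_shift ℓ x.1.1 (wshF H₀ x) (toWin H₀ x)
  rw [shiftPairW_toWin] at h
  rw [h]; rfl

/-- `n9F` of a translated window pair. [g100] -/
theorem n9F_shift_win (ℓ : ℤ → ℤ) (H₀ : ℕ) (x q : (Cell 2 × ℤ) × (Cell 2 × ℤ)) :
    n9F ℓ (shiftPairW x.1.1 (wshF H₀ x) q) = n9F (winSeq ℓ H₀ x.1.2) q := n9F_shift ℓ _ _ q

/-- `sinSq0F` of two translated window pairs. [g100] -/
theorem sinSq0F_shift_win (ℓ : ℤ → ℤ) (H₀ : ℕ) (x u v : (Cell 2 × ℤ) × (Cell 2 × ℤ)) :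
    sinSq0F ℓ (shiftPairW x.1.1 (wshF H₀ x) u) (shiftPairW x.1.1 (wshF H₀ x) v) = sinSq0F (winSeq ℓ H₀ x.1.2) u v :=
  sinSq0F_shift ℓ _ _ u v

/-! ### §2 the lookup in the window of the base layer -/

/-- the datum of a pair: the first datum of the window data AT ITS BASE LAYER whose pair is the window representative, if any. [g100] -/
def dataLookupF (H₀ : ℕ) (cdW : ℤ → List ChordDatum) (x : (Cell 2 × ℤ) × (Cell 2 × ℤ)) : Option ChordDatum :=
  (cdW x.1.2).find? fun c => decide (c.1 = toWin H₀ x)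

/-- number of pieces READ OFF the window data (default 1). [g100] -/
def dataNpF (H₀ : ℕ) (cdW : ℤ → List ChordDatum) (x : (Cell 2 × ℤ) × (Cell 2 × ℤ)) : ℕ :=
  match dataLookupF H₀ cdW x with
  | some c => chordNp c
  | none => 1

/-- path nodes READ OFF the window data, translated back to `x` (default: the one-piece path). [g100] -/
def dataZF (H₀ : ℕ) (cdW : ℤ → List ChordDatum) (x : (Cell 2 × ℤ) × (Cell 2 × ℤ)) (i : ℕ) : Cell 2 × ℤ :=
  match dataLookupF H₀ cdW x with
  | some c => shiftSiteW x.1.1 (wshF H₀ x) ((chordNodes c).getD i c.1.2)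
  | none => if i = 0 then x.1 else x.2

/-- the datum found is a member of the window data at the base layer and is based at the window representative. [g100] -/
theorem lookupF_sound {H₀ : ℕ} {cdW : ℤ → List ChordDatum} {x : (Cell 2 × ℤ) × (Cell 2 × ℤ)} {c : ChordDatum}
    (h : dataLookupF H₀ cdW x = some c) : c ∈ cdW x.1.2 ∧ c.1 = toWin H₀ x := by
  refine ⟨List.mem_of_find?_eq_some h, ?_⟩
  have := List.find?_some h
  simpa using this

/-- completeness of the window data at the representative makes the lookup succeed. [g100] -/
theorem lookupF_of_complete {H₀ : ℕ} {cdW : ℤ → List ChordDatum} {x : (Cell 2 × ℤ) × (Cell 2 × ℤ)}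
    (hc : ∃ c ∈ cdW x.1.2, c.1 = toWin H₀ x) : ∃ c ∈ cdW x.1.2, dataLookupF H₀ cdW x = some c := by
  obtain ⟨c, hc, hcx⟩ := hc
  have hsome : (dataLookupF H₀ cdW x).isSome = true := by
    unfold dataLookupF
    rw [List.find?_isSome]
    exact ⟨c, hc, by simpa using hcx⟩
  obtain ⟨c', hc'⟩ := Option.isSome_iff_exists.mp hsome
  exact ⟨c', (lookupF_sound hc').1, hc'⟩

/-- number of pieces read off a successful lookup. [g100] -/
theorem dataNpF_of_lookup {H₀ : ℕ} {cdW : ℤ → List ChordDatum} {x : (Cell 2 × ℤ) × (Cell 2 × ℤ)} {c : ChordDatum}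
    (h : dataLookupF H₀ cdW x = some c) : dataNpF H₀ cdW x = chordNp c := by
  simp only [dataNpF, h]

/-- path nodes read off a successful lookup. [g100] -/
theorem dataZF_of_lookup {H₀ : ℕ} {cdW : ℤ → List ChordDatum} {x : (Cell 2 × ℤ) × (Cell 2 × ℤ)} {c : ChordDatum}
    (h : dataLookupF H₀ cdW x = some c) (i : ℕ) : dataZF H₀ cdW x i = shiftSiteW x.1.1 (wshF H₀ x) ((chordNodes c).getD i c.1.2) := by
  simp only [dataZF, h]

/-- ★ the pieces read off the window data are the translated chord pieces. [g100] -/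
theorem piece_dataZF {H₀ : ℕ} {cdW : ℤ → List ChordDatum} {x : (Cell 2 × ℤ) × (Cell 2 × ℤ)} {c : ChordDatum}
    (h : dataLookupF H₀ cdW x = some c) (i : ℕ) : piece (dataZF H₀ cdW) x i = shiftPairW x.1.1 (wshF H₀ x) (chordPiece c i) := by
  simp only [piece, dataZF_of_lookup h, shiftPairW, chordPiece]

/-! ### §3 far pairs under the letter-function comparisons -/

/-- `0 ≤ n9F`. [g100] -/
theorem n9F_nonneg (ℓ : ℤ → ℤ) (x : (Cell 2 × ℤ) × (Cell 2 × ℤ)) : 0 ≤ n9F ℓ x := by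
  unfold n9F
  nlinarith [sq_nonneg (2 * (refF0 ℓ x.2 - refF0 ℓ x.1) + (refF1 ℓ x.2 - refF1 ℓ x.1)), sq_nonneg (refF1 ℓ x.2 - refF1 ℓ x.1),
    sq_nonneg (x.2.2 - x.1.2)]

/-- a far pair has positive ideal length. [g100] -/
theorem n9F_pos_of_far {ℓ : ℤ → ℤ} {lam mu ϱ : ℝ} {a b : E3} {w : ℤ → E3} (hϱ : 0 ≤ ϱ) (hL : IdealLengthCmpF ℓ lam mu a b w)
    {x : (Cell 2 × ℤ) × (Cell 2 × ℤ)} (hx : ϱ < ‖bondVec a b w x‖) : 0 < n9F ℓ x := by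
  have h2 := (hL x).2
  have hr : 0 < ‖bondVec a b w x‖ := hϱ.trans_lt hx
  rcases lt_or_ge 0 (n9F ℓ x) with h | h
  · exact h
  · exfalso
    have hc : (n9F ℓ x : ℝ) ≤ 0 := by exact_mod_cast h
    nlinarith [sq_nonneg mu, mul_le_mul_of_nonneg_left hc (sq_nonneg mu)]

/-- a far pair has ideal length above the far cut `lo`. [g100] -/
theorem lo_lt_n9F_of_far {ℓ : ℤ → ℤ} {lam mu ϱ : ℝ} {lo : ℤ} {a b : E3} {w : ℤ → E3} (hϱ : 0 ≤ ϱ) (hL : IdealLengthCmpF ℓ lam mu a b w)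
    (hlo : mu ^ 2 * (lo : ℝ) ≤ 9 * ϱ ^ 2) {x : (Cell 2 × ℤ) × (Cell 2 × ℤ)} (hx : ϱ < ‖bondVec a b w x‖) : lo < n9F ℓ x := by
  have h2 := (hL x).2
  have hϱ2 : ϱ ^ 2 < ‖bondVec a b w x‖ ^ 2 := by nlinarith [norm_nonneg (bondVec a b w x)]
  rcases lt_or_ge lo (n9F ℓ x) with h | h
  · exact h
  · exfalso
    have hc : (n9F ℓ x : ℝ) ≤ lo := by exact_mod_cast h
    nlinarith [sq_nonneg mu, mul_le_mul_of_nonneg_left hc (sq_nonneg mu)]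

/-! ### §4 the key at a base layer; the guarded tables as incidence sums -/

/-- THE KEY of a piece `y` SEEN FROM base layer `m`: `(y.1.2 − m + H₀, Δγ₀, Δγ₁, Δm)` (= `pieceKeyF` of `y` in the window coordinates of `m`).
[g100] -/
def keyAtF (H₀ : ℕ) (m : ℤ) (y : (Cell 2 × ℤ) × (Cell 2 × ℤ)) : ℤ × ℤ × ℤ × ℤ :=
  (y.1.2 - m + H₀, y.2.1 0 - y.1.1 0, y.2.1 1 - y.1.1 1, y.2.2 - y.1.2)

/-- the key of a translated window piece seen from the base layer is the raw key of the piece. [g100] -/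
theorem keyAtF_shift (H₀ : ℕ) (x q : (Cell 2 × ℤ) × (Cell 2 × ℤ)) : keyAtF H₀ x.1.2 (shiftPairW x.1.1 (wshF H₀ x) q) = pieceKeyF q := by
  simp only [keyAtF, pieceKeyF, shiftPairW, shiftSiteW, wshF, Pi.add_apply]
  refine Prod.ext ?_ (Prod.ext ?_ (Prod.ext ?_ ?_)) <;> simp only <;> ring

/-- the guarded R table with a scalar, as the `Q`-restricted incidence sum of the counting lemma. [g100] -/
theorem tableRG_eq {ℓ : ℤ → ℤ} {lo hi : ℤ} {cd : List ChordDatum} (hnd : cd.Nodup) (κ : ℝ) (k : ℤ × ℤ × ℤ × ℤ) :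
    (∑ c ∈ cd.toFinset, ∑ i ∈ Finset.range (chordNp c),
        if pieceKeyF (chordPiece c i) = k ∧ (lo < n9F ℓ c.1 ∧ n9F ℓ c.1 ≤ hi) then κ * coefR0F ℓ c else 0) =
      κ * thetaR0G ℓ lo hi cd k := by
  unfold thetaR0G
  rw [← List.sum_toFinset _ hnd, Finset.mul_sum]
  refine Finset.sum_congr rfl fun c _ => ?_
  by_cases hr : lo < n9F ℓ c.1 ∧ n9F ℓ c.1 ≤ hi
  · rw [if_pos hr, Finset.mul_sum]
    refine Finset.sum_congr rfl fun i _ => ?_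
    by_cases hk : pieceKeyF (chordPiece c i) = k
    · rw [if_pos ⟨hk, hr⟩, if_pos hk]
    · rw [if_neg fun h => hk h.1, if_neg hk, mul_zero]
  · rw [if_neg hr, mul_zero]
    exact Finset.sum_eq_zero fun i _ => if_neg fun h => hr h.2

/-- the guarded N table (with the `η`-multiple of the R table) as the `Q`-restricted incidence sum. [g100] -/
theorem tableNG_eq {ℓ : ℤ → ℤ} {lo hi : ℤ} {cd : List ChordDatum} (hnd : cd.Nodup) (κ K η : ℝ) (k : ℤ × ℤ × ℤ × ℤ) :
    (∑ c ∈ cd.toFinset, ∑ i ∈ Finset.range (chordNp c),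
        if pieceKeyF (chordPiece c i) = k ∧ (lo < n9F ℓ c.1 ∧ n9F ℓ c.1 ≤ hi) then κ * (K * coefN0F ℓ c i + η * coefR0F ℓ c) else 0) =
      κ * (K * thetaN0G ℓ lo hi cd k + η * thetaR0G ℓ lo hi cd k) := by
  unfold thetaN0G thetaR0G
  rw [← List.sum_toFinset _ hnd, ← List.sum_toFinset _ hnd, Finset.mul_sum, Finset.mul_sum, ← Finset.sum_add_distrib, Finset.mul_sum]
  refine Finset.sum_congr rfl fun c _ => ?_
  by_cases hr : lo < n9F ℓ c.1 ∧ n9F ℓ c.1 ≤ hi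
  · rw [if_pos hr, if_pos hr, Finset.mul_sum, Finset.mul_sum, ← Finset.sum_add_distrib, Finset.mul_sum]
    refine Finset.sum_congr rfl fun i _ => ?_
    by_cases hk : pieceKeyF (chordPiece c i) = k
    · rw [if_pos ⟨hk, hr⟩, if_pos hk, if_pos hk]
    · rw [if_neg fun h => hk h.1, if_neg hk, if_neg hk]; ring
  · rw [if_neg hr, if_neg hr, mul_zero, mul_zero, add_zero, mul_zero]
    exact Finset.sum_eq_zero fun i _ => if_neg fun h => hr h.2

/-- ★ valid window data has NO incidence beyond the radius: the guarded R table vanishes at keys with `|k.1 − H₀| > R`. [g100] -/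
theorem thetaR0G_eq_zero_of_far {H₀ R : ℕ} {ℓ : ℤ → ℤ} {lo hi P9max : ℤ} {cd : List ChordDatum}
    (hV : ChordDataValidF H₀ R ℓ lo hi P9max cd) {k : ℤ × ℤ × ℤ × ℤ} (hk : ¬ |k.1 - H₀| ≤ R) : thetaR0G ℓ lo hi cd k = 0 := by
  unfold thetaR0G
  refine List.sum_eq_zero fun t ht => ?_
  obtain ⟨c, hc, rfl⟩ := List.mem_map.1 ht
  split_ifs
  · refine Finset.sum_eq_zero fun i hi => if_neg fun hki => hk ?_
    rw [← hki]
    exact ((hV.1 c hc).2.1 i (Finset.mem_range.1 hi)).1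
  · rfl

/-- the guarded N table vanishes at keys beyond the radius. [g100] -/
theorem thetaN0G_eq_zero_of_far {H₀ R : ℕ} {ℓ : ℤ → ℤ} {lo hi P9max : ℤ} {cd : List ChordDatum}
    (hV : ChordDataValidF H₀ R ℓ lo hi P9max cd) {k : ℤ × ℤ × ℤ × ℤ} (hk : ¬ |k.1 - H₀| ≤ R) : thetaN0G ℓ lo hi cd k = 0 := by
  unfold thetaN0G
  refine List.sum_eq_zero fun t ht => ?_
  obtain ⟨c, hc, rfl⟩ := List.mem_map.1 ht
  split_ifs
  · refine Finset.sum_eq_zero fun i hi => if_neg fun hki => hk ?_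
    rw [← hki]
    exact ((hV.1 c hc).2.1 i (Finset.mem_range.1 hi)).1
  · rfl

/-- the radius window of base layers around a piece: `|y.1.2 − m| ≤ R ↔ m ∈ [y.1.2 − R, y.1.2 + R]`, read off the key. [g100] -/
theorem mem_Icc_of_key {H₀ R : ℕ} {m : ℤ} {y : (Cell 2 × ℤ) × (Cell 2 × ℤ)} (h : |(keyAtF H₀ m y).1 - H₀| ≤ R) :
    m ∈ Finset.Icc (y.1.2 - R) (y.1.2 + R) := by
  simp only [keyAtF, add_sub_cancel_right] at h
  rw [Finset.mem_Icc]
  obtain ⟨h1, h2⟩ := abs_le.mp h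
  constructor <;> linarith

/-! ### §5 per-incidence coefficient bounds -/

/-- the common facts of a far pair with a datum: `n9F ℓ x = n9F ℓₘ c.1 > 0` and `a₋(‖e_x‖) ≤ 45927/(λ⁸·n9⁴)`. [g100] -/
theorem far_datum_factsF {H₀ : ℕ} {ℓ : ℤ → ℤ} {cdW : ℤ → List ChordDatum} {lam mu ϱ : ℝ} {a b : E3} {w : ℤ → E3} (hϱ : 0 ≤ ϱ)
    (hlam : 0 < lam) (hL : IdealLengthCmpF ℓ lam mu a b w) {x : (Cell 2 × ℤ) × (Cell 2 × ℤ)} (hx : ϱ < ‖bondVec a b w x‖)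
    {c : ChordDatum} (hcx : dataLookupF H₀ cdW x = some c) :
    n9F ℓ x = n9F (winSeq ℓ H₀ x.1.2) c.1 ∧ 0 < n9F (winSeq ℓ H₀ x.1.2) c.1 ∧
      aMinus ‖bondVec a b w x‖ ≤ 45927 / (lam ^ 8 * (n9F (winSeq ℓ H₀ x.1.2) c.1 : ℝ) ^ 4) := by
  have hn9 : n9F ℓ x = n9F (winSeq ℓ H₀ x.1.2) c.1 := by rw [(lookupF_sound hcx).2, n9F_toWin]
  have hpos : 0 < n9F (winSeq ℓ H₀ x.1.2) c.1 := by rw [← hn9]; exact n9F_pos_of_far hϱ hL hx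
  refine ⟨hn9, hpos, (aMinus_le_div _).trans (seven_div_pow_eight_le hlam hpos ?_)⟩
  rw [← hn9]
  exact (hL x).1

/-- ★ STRETCH coefficient of an incidence of a far listed pair: `≤ (1+α)·λ⁻⁸·coefR0F ℓₘ c`. [g100] -/
theorem schemeCoefR_le_coefR0F {H₀ : ℕ} {ℓ : ℤ → ℤ} {cdW : ℤ → List ChordDatum} {ϱ α lam mu : ℝ} {a b : E3} {w : ℤ → E3}
    (hϱ : 0 ≤ ϱ) (hα : 0 < α) (hlam : 0 < lam) (hL : IdealLengthCmpF ℓ lam mu a b w) {x : (Cell 2 × ℤ) × (Cell 2 × ℤ)}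
    (hx : ϱ < ‖bondVec a b w x‖) {c : ChordDatum} (hcx : dataLookupF H₀ cdW x = some c) (i : ℕ) :
    schemeCoefR α a b w (dataNpF H₀ cdW) (dataZF H₀ cdW) x i ≤ (1 + α) * (lam ^ 8)⁻¹ * coefR0F (winSeq ℓ H₀ x.1.2) c := by
  obtain ⟨_, hpos, hb⟩ := far_datum_factsF hϱ hlam hL hx hcx
  have hpos' : (0 : ℝ) < n9F (winSeq ℓ H₀ x.1.2) c.1 := by exact_mod_cast hpos
  unfold schemeCoefR coefR0F
  rw [dataNpF_of_lookup hcx]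
  calc (1 + α) * (chordNp c : ℝ) * cosSq a b w (dataZF H₀ cdW) x i * aMinus ‖bondVec a b w x‖
      ≤ (1 + α) * (chordNp c : ℝ) * 1 * (45927 / (lam ^ 8 * (n9F (winSeq ℓ H₀ x.1.2) c.1 : ℝ) ^ 4)) :=
        mul_le_mul (mul_le_mul_of_nonneg_left (cosSq_le_one _ _ _ _ _ _) (by positivity)) hb (aMinus_nonneg _) (by positivity)
    _ = (1 + α) * (lam ^ 8)⁻¹ * ((chordNp c : ℝ) * 45927 / (n9F (winSeq ℓ H₀ x.1.2) c.1 : ℝ) ^ 4) := by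
        have h1 : lam ≠ 0 := hlam.ne'
        have h2 : (n9F (winSeq ℓ H₀ x.1.2) c.1 : ℝ) ≠ 0 := hpos'.ne'
        field_simp

/-- ★ NORM coefficient of an incidence of a far listed pair IN RANGE: `≤ (1+α⁻¹)·λ⁻⁸·(K·coefN0F + η·coefR0F)`. [g100] -/
theorem schemeCoefN_le_coefN0F {H₀ R : ℕ} {ℓ : ℤ → ℤ} {lo hi P9max : ℤ} {cdW : ℤ → List ChordDatum} {ϱ α lam mu K η : ℝ} {a b : E3}
    {w : ℤ → E3} (hϱ : 0 ≤ ϱ) (hα : 0 < α) (hlam : 0 < lam) (hL : IdealLengthCmpF ℓ lam mu a b w) (hA : IdealAngleCmpF ℓ K η a b w)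
    {x : (Cell 2 × ℤ) × (Cell 2 × ℤ)} (hV : ChordDataValidF H₀ R (winSeq ℓ H₀ x.1.2) lo hi P9max (cdW x.1.2))
    (hx : ϱ < ‖bondVec a b w x‖) (hlo : lo < n9F ℓ x) (hhi : n9F ℓ x ≤ hi) {c : ChordDatum} (hcx : dataLookupF H₀ cdW x = some c)
    {i : ℕ} (hi : i < chordNp c) :
    schemeCoefN α a b w (dataNpF H₀ cdW) (dataZF H₀ cdW) x i ≤
      (1 + α⁻¹) * (lam ^ 8)⁻¹ * (K * coefN0F (winSeq ℓ H₀ x.1.2) c i + η * coefR0F (winSeq ℓ H₀ x.1.2) c) := by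
  obtain ⟨hn9, hpos, hb⟩ := far_datum_factsF hϱ hlam hL hx hcx
  set ℓ' := winSeq ℓ H₀ x.1.2 with hℓ'
  have hpos' : (0 : ℝ) < n9F ℓ' c.1 := by exact_mod_cast hpos
  obtain ⟨hmem, hc1⟩ := lookupF_sound hcx
  have hq : 0 < n9F ℓ' (chordPiece c i) := ((hV.1 c hmem).2.2 (by rwa [← hn9]) (by rwa [← hn9]) i hi).1
  have hqn : n9F ℓ (shiftPairW x.1.1 (wshF H₀ x) (chordPiece c i)) = n9F ℓ' (chordPiece c i) := n9F_shift_win ℓ H₀ x _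
  have hs : sinSqPair a b w x (shiftPairW x.1.1 (wshF H₀ x) (chordPiece c i)) ≤ K * sinSq0F ℓ' c.1 (chordPiece c i) + η := by
    have h := hA x (shiftPairW x.1.1 (wshF H₀ x) (chordPiece c i)) (by rw [hn9]; exact hpos) (by rw [hqn]; exact hq)
    have e1 : x = shiftPairW x.1.1 (wshF H₀ x) c.1 := by rw [hc1, shiftPairW_toWin]
    have hs0 : sinSq0F ℓ x (shiftPairW x.1.1 (wshF H₀ x) (chordPiece c i)) = sinSq0F ℓ' c.1 (chordPiece c i) := by
      calc sinSq0F ℓ x (shiftPairW x.1.1 (wshF H₀ x) (chordPiece c i))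
          = sinSq0F ℓ (shiftPairW x.1.1 (wshF H₀ x) c.1) (shiftPairW x.1.1 (wshF H₀ x) (chordPiece c i)) := by rw [← e1]
        _ = sinSq0F ℓ' c.1 (chordPiece c i) := sinSq0F_shift_win ℓ H₀ x _ _
    rw [hs0] at h
    exact h
  have hs' : 0 ≤ sinSqPair a b w x (shiftPairW x.1.1 (wshF H₀ x) (chordPiece c i)) := sinSqPair_nonneg _ _ _ _ _
  unfold schemeCoefN coefN0F coefR0F
  rw [dataNpF_of_lookup hcx, one_sub_cosSq, piece_dataZF hcx]
  unfold sinSq0F at hs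
  calc (1 + α⁻¹) * (chordNp c : ℝ) * sinSqPair a b w x (shiftPairW x.1.1 (wshF H₀ x) (chordPiece c i)) * aMinus ‖bondVec a b w x‖
      ≤ (1 + α⁻¹) * (chordNp c : ℝ) * (K * (1 - (d18F ℓ' c.1 (chordPiece c i) : ℝ) ^ 2 / (4 * n9F ℓ' c.1 * n9F ℓ' (chordPiece c i))) + η) *
          (45927 / (lam ^ 8 * (n9F ℓ' c.1 : ℝ) ^ 4)) :=
        mul_le_mul (mul_le_mul_of_nonneg_left hs (by positivity)) hb (aMinus_nonneg _) (mul_nonneg (by positivity) (hs'.trans hs))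
    _ = (1 + α⁻¹) * (lam ^ 8)⁻¹ * (K * ((chordNp c : ℝ) * 45927 *
          (1 - (d18F ℓ' c.1 (chordPiece c i) : ℝ) ^ 2 / (4 * n9F ℓ' c.1 * n9F ℓ' (chordPiece c i))) / (n9F ℓ' c.1 : ℝ) ^ 4) +
          η * ((chordNp c : ℝ) * 45927 / (n9F ℓ' c.1 : ℝ) ^ 4)) := by
        have h1 : lam ≠ 0 := hlam.ne'
        have h2 : (n9F ℓ' c.1 : ℝ) ≠ 0 := hpos'.ne'
        field_simp

/-- the N-table entries of a chord IN RANGE are non-negative: `K·coefN0F + η·coefR0F ≥ 0` (angle comparison at the translated datum). [g100] -/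
theorem coefN_table_nonnegF {H₀ R : ℕ} {ℓ : ℤ → ℤ} {lo hi P9max : ℤ} {cd : List ChordDatum} {K η : ℝ} {a b : E3} {w : ℤ → E3} {m : ℤ}
    (hA : IdealAngleCmpF ℓ K η a b w) (hV : ChordDataValidF H₀ R (winSeq ℓ H₀ m) lo hi P9max cd) {c : ChordDatum} (hc : c ∈ cd)
    (hr : lo < n9F (winSeq ℓ H₀ m) c.1 ∧ n9F (winSeq ℓ H₀ m) c.1 ≤ hi) {i : ℕ} (hi : i < chordNp c) :
    0 ≤ K * coefN0F (winSeq ℓ H₀ m) c i + η * coefR0F (winSeq ℓ H₀ m) c := by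
  set ℓ' := winSeq ℓ H₀ m with hℓ'
  unfold coefN0F coefR0F
  rcases (n9F_nonneg ℓ' c.1).eq_or_lt with h0 | hpos
  · rw [← h0]
    simp
  · have hq : 0 < n9F ℓ' (chordPiece c i) := ((hV.1 c hc).2.2 hr.1 hr.2 i hi).1
    let x0 : (Cell 2 × ℤ) × (Cell 2 × ℤ) := ((0, m), (0, m))
    have hw : wshF H₀ x0 = m - H₀ := rfl
    have e9 : ∀ q, n9F ℓ (shiftPairW x0.1.1 (wshF H₀ x0) q) = n9F ℓ' q := fun q => n9F_shift_win ℓ H₀ x0 q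
    have es : sinSq0F ℓ (shiftPairW x0.1.1 (wshF H₀ x0) c.1) (shiftPairW x0.1.1 (wshF H₀ x0) (chordPiece c i)) =
        sinSq0F ℓ' c.1 (chordPiece c i) := sinSq0F_shift_win ℓ H₀ x0 _ _
    have hs := (sinSqPair_nonneg a b w _ _).trans (hA _ _ (by rw [e9]; exact hpos) (by rw [e9]; exact hq))
    rw [es] at hs
    unfold sinSq0F at hs
    have hpos' : (0 : ℝ) < n9F ℓ' c.1 := by exact_mod_cast hpos
    have : K * ((chordNp c : ℝ) * 45927 * (1 - (d18F ℓ' c.1 (chordPiece c i) : ℝ) ^ 2 / (4 * n9F ℓ' c.1 * n9F ℓ' (chordPiece c i))) /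
          (n9F ℓ' c.1 : ℝ) ^ 4) + η * ((chordNp c : ℝ) * 45927 / (n9F ℓ' c.1 : ℝ) ^ 4) =
        (chordNp c : ℝ) * 45927 / (n9F ℓ' c.1 : ℝ) ^ 4 *
          (K * (1 - (d18F ℓ' c.1 (chordPiece c i) : ℝ) ^ 2 / (4 * n9F ℓ' c.1 * n9F ℓ' (chordPiece c i))) + η) := by ring
    rw [this]
    exact mul_nonneg (by positivity) hs

end Summit.AtomisticToContinuum.Crystallization.Theorems.ChartedZeroExcessLayeredLatticeLiouville
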